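import Summits.BirchSwinnertonDyer.BirchSwinnertonDyer.Theorems.TwoAdicConverseLambdaHalfTowerDoor
import Summits.BirchSwinnertonDyer.BirchSwinnertonDyer.Theorems.TwoAdicConverseLambdaHalfIsogeny
import Summits.BirchSwinnertonDyer.BirchSwinnertonDyer.Theorems.ByReductionTypeAtTwoTowerClass99693a
import Summits.BirchSwinnertonDyer.BirchSwinnertonDyer.Theorems.ByReductionTypeAtTwoTowerClass99693aA
import HarnessLib

/-!
# Route `TwoAdicConverse` (rung S3), crux `OrdLambdaHalfAtTwo` (item 19556): the `λ`-half AT THE K4 TOWER CLASSES, batch B47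
# (1 classes: 99693a)

Cell `bsd-2adic` (run/shared/lean/pub/bsd-2adic/), seat `bsd-2adic-conv-1x` (WIDTH-LEVER second lane on item 19556, GEN 0; generator
`gen/gen_s3.py` over the landed K4 tower class files `Theorems/ByReductionTypeAtTwoTowerClass*.lean` of seats ord-2 / ord-3 / tower-1).
THEOREMS ONLY — no definition, no named fact, no axiom, no `sorry`; every curve, certificate shape and kernel-decided datum is the K4
class file's, imported (never re-typed).

For each class member `<L>` displayed by K4:
* `lambdaHalfAtTwo_<L>_lambdaRoad_… / _npRoad_… / _addRoad_…` — **KATO-FREE**: item 19556's per-curve predicate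
  `TwoAdicTwistConverse.LambdaHalfAtTwo c<L>` from the K4 `λ`-road display's certificates with {`h17`, `hEC`, `hGZK`, `hr`, `hμan`}
  STRUCK (doors `lambdaHalfAtTwo_of_towerGap_of_layerSelmer` / `lambdaHalfAtTwo_of_lambda_le`, file
  `TwoAdicConverseLambdaHalfTowerDoor`): PRINT {`hmod`, `h414` | `hF1` `hF3a` `hB` | `h415` `hB`, `hAU` | `hper₀`} + CERT {gap counts,
  the (relaxed) layer rank count, `λ_an = n`}.
* `lambdaHalfAtTwo_<L>_of_towerGap` / `_<row>` / `_…_viaMC` — BY NAME from the K4 display `mazurMainConjecture_two_<L>_…` (Mazur's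
  `2`-adic main conjecture at `<L>`, PRINT Kato 17.4 (1)(2)@2 `h17` INCLUDED, `Ш`-road or `λ`-road certificates) and conv-1's
  `lambdaHalfAtTwo_of_mazurMainConjecture`.
* `lambdaHalfAtTwo_class_<cls>_of_member` — the leaf at every other Cremona member along the K4 file's kernel-checked Vélu
  isogenies (conv-1's unconditional `lambdaHalfAtTwo_of_isIsogenous`), where the K4 class file has them.

HONEST FRAMING: class-level theorems modulo the displayed binders; nothing is booked by this file (D-0054); no binder is discharged;
item 19556 (= the `λ`-part of Kato's `2`-adic main conjecture on «non-CM, good ordinary at `2`») stays OPEN at the `∀`-level; BSD is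
not proved by any of this; a closed item would close a rung leaf (S3), never the summit. PARTITION (D-0054): none — RANK axis (S3);
companion formula cell X5@2 good-ord (B1·O1; the K4 TOWER habitat, these classes); types-the-object-of; closes none; bears_on: S3
(19556) + K4 (19271/19573/19577 rows of the same classes, same certificates).
References: R. Greenberg, LNM 1716 (1999), §1, §3, Prop. 4.14/4.15 [GreenbergLNM1716]; K. Matsuno, Int. J. Number Theory 4 (2008)
[Matsuno2008]; K. Kato, Astérisque 295 (2004), Thm. 17.4 [Kato2004Asterisque]; R. Greenberg, V. Vatsal, Invent. Math. 142 (2000), p. 4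
[GreenbergVatsal2000]; J. Cremona, *Algorithms for Modular Elliptic Curves* (1997), Table 1 [CremonaAlgorithms1997].
-/

set_option autoImplicit false
-- the route's Theorems namespace repeats a component by design (summit = sub-problem, D-0017).
set_option linter.dupNamespace false

noncomputable section

open scoped Classical MatrixGroups ModularForm

open NumberField IsDedekindDomain CongruenceSubgroup WeierstrassCurve Literature.NumberTheory.EllipticCurves
  Literature.NumberTheory.EllipticCurves.ModularForms Literature.NumberTheory.EllipticCurves.Rank1Residual
  Literature.NumberTheory.EllipticCurves.Rank1Residual.Typed
  Literature.NumberTheory.EllipticCurves.Greenberg1999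
  Literature.NumberTheory.EllipticCurves.GreenbergVatsal2000
  Literature.NumberTheory.EllipticCurves.Matsuno2008
  Literature.NumberTheory.EllipticCurves.PolyCert
  Summit.BirchSwinnertonDyer.Rank1Residual.X1.MuLambda
  Summit.BirchSwinnertonDyer.Rank1Residual.X1.MuPart
  Summit.BirchSwinnertonDyer.Rank1Residual.X1.ParitySqueeze
  Summit.BirchSwinnertonDyer.Rank1Residual.X5 Summit.BirchSwinnertonDyer.Rank1Residual.X5.O1
  Summit.BirchSwinnertonDyer.Rank1Residual.X5.TowerGap Summit.BirchSwinnertonDyer.Rank1Residual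
  Summit.BirchSwinnertonDyer.Rank1Residual.X5.Instances
  Summit.BirchSwinnertonDyer.BirchSwinnertonDyer.Theorems
  Summit.BirchSwinnertonDyer.BirchSwinnertonDyer.Theorems.KatoHalfPinch
  Summit.BirchSwinnertonDyer.BirchSwinnertonDyer.Theorems.TowerLambdaNonPrimitive
  Summit.BirchSwinnertonDyer.BirchSwinnertonDyer.Theorems.TowerLambdaTorsion
  Summit.BirchSwinnertonDyer.BirchSwinnertonDyer.Theorems.Rank1ResidualX1Defs
  Rat.HeightOneSpectrum

namespace Summit.BirchSwinnertonDyer.BirchSwinnertonDyer.Theorems.TowerClass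

/-! ## Class `99693a` — K4 file `ByReductionTypeAtTwoTowerClass99693a` -/

/-- **Item 19556's leaf AT `99693a1`, BY NAME from the K4 display `mazurMainConjecture_two_99693a1_of_towerGap`** (Mazur's `2`-adic IMC at `99693a1`,
PRINT Kato 17.4 (1)(2)@2 `h17` INCLUDED) ∘ conv-1's `lambdaHalfAtTwo_of_mazurMainConjecture`; binders = the display's.
[cite: GreenbergVatsal2000, p. 4 (after Thm. (1.2))] [cite: Kato2004Asterisque, Thm. 17.4 (1)(2) (p. 273)] -/
theorem lambdaHalfAtTwo_99693a1_of_towerGap (hEC : TwoAdicEulerCharRankZero c99693a1 0)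
    (hmod : nonempty_modularParametrizationData) (hGZK : rank_eq_analyticRank_of_analyticRank_le_one)
    (h17 : ∀ [NeZero (c99693a1.conductorNorm ℤ)] (f : CuspForm (Gamma0 (c99693a1.conductorNorm ℤ)) 2),
      kato_divisibility_allPrimes c99693a1 2 (f := f))
    (hAU : abbesUllmo_not_dvd_maninConstant_of_not_dvd_level) (hr : c99693a1.analyticRank = 0)
    (hgap : TowerGapAtTwo c99693a1) (hsha : MissingLowerBoundAt c99693a1 2) :
    TwoAdicTwistConverse.LambdaHalfAtTwo c99693a1 :=
  TwoAdicTwistConverse.lambdaHalfAtTwo_of_mazurMainConjecture c99693a1 hmod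
    (mazurMainConjecture_two_99693a1_of_towerGap hEC hmod hGZK h17 hAU hr hgap hsha)

end Summit.BirchSwinnertonDyer.BirchSwinnertonDyer.Theorems.TowerClass

end
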